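import Summits.BirchSwinnertonDyer.BirchSwinnertonDyer.Theorems.PrintX8SmallImageTotallyRamified
import Literature.NumberTheory.EllipticCurves.FineSelmerMuRoadDoors
import HarnessLib

/-!
# K9 `WildCoatesSujathaResidue` (stmt-19942) / KT `TameCoatesSujathaResidue` (stmt-19916) — road (b) BY NAME with the
# Fukuda index binder discharged: (A) at `(W, p)` from two class-group integers of `ℚ(W[p])`, for ANY curve whose
# `p`-division field has degree prime to `p` (cell `bsd-potss`, seat `conjA-anchor` g8; `--supports` 19942; closes nothing)

HONEST FRAMING.  `Literature/…/FineSelmerMuRoadDoors.lean` (p572797) gives the three class-free doors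
Iwasawa-1956 / Fukuda (1) / Fukuda (2) ∘ Coates–Sujatha Thm. 3.4; the Fukuda doors carry the binder
`hram : ∀ κL cyclotomic, TotallyRamifiedFrom κL 0`.  `Theorems/PrintX8SmallImageTotallyRamified.lean` (cell
bsd-print-x8, p2 g3) PROVES that binder for every number field `K ⊂ ℚ̄` normal over `ℚ` whose automorphism group has
exponent dividing some `d` with `p ∤ d` (§1 `pow_mem_range_absGaloisRestrict_of_pow_eq_one`, §2
`totallyRamifiedFrom_zero_of_isCyclotomic_of_pow_mem_range`), and applies it on X8 ∩ ¬surj (`#Gal = 16`).  This file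
is the CLASS-FREE application with `d := #Gal(ℚ(W[p])/ℚ)`: the only remaining structural hypothesis is the NUMERIC
`p ∤ #Gal(ℚ(W[p])/ℚ)` (true on every U₀-Cartan row at `p = 3`: `#Gal ∈ {8, 16}`; false for `ρ̄` onto, `#Gal = 48`).
With it, a per-row record of the seat's `p = 3` census (kit j290399 + j289900: Fukuda door open at the layers (0,1)
directly on `ℚ(W[3])` for 27 Ns rows, Iwasawa-1956 door for 273 rows) is a one-line application displaying integers
only.  Nothing here is new mathematics; (A) is asserted for no curve unconditionally (the named facts Fukuda 1994 /
Coates–Sujatha 2005 stay hypotheses `hF1`/`hF2`/`hCS`).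

References: [Fukuda1994] Thm. 1, p. 264; [CoatesSujatha2005] Thm. 3.4; [Washington1997] §13.1, Prop. 13.2.
-/

set_option linter.dupNamespace false

namespace Summit.BirchSwinnertonDyer.BirchSwinnertonDyer.Theorems.CartanMuRoadDoors

open WeierstrassCurve Literature.NumberTheory.EllipticCurves Literature.NumberTheory.IwasawaTheory
open Literature.NumberTheory.GaloisRepresentations Field
open Summit.BirchSwinnertonDyer.BirchSwinnertonDyer.Theorems.PrintX8TotallyRamified

/-- **Fukuda's index is `n₀ = 0` for the cyclotomic `ℤ_p`-tower of `ℚ(W[p])` whenever `p ∤ #Gal(ℚ(W[p])/ℚ)`**: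
every prime of `\bar ℤ_L` is unramified or totally ramified in `L_∞/L`, `L = ℚ(W[p])` (X8 file §2 with
`d = #Gal`, §1 with `s ^ #Gal = 1`). [cite: Fukuda1994, p. 264 (the index `n₀`)] [cite: Washington1997, §13.1 and Prop. 13.2] -/
theorem totallyRamifiedFrom_zero_divisionField_of_not_dvd_card (W : WeierstrassCurve ℚ) [W.IsElliptic]
    (p : ℕ) [Fact p.Prime]
    (hd : haveI : NeZero p := ⟨(Fact.out : p.Prime).ne_zero⟩
      ¬ p ∣ Nat.card ((W.divisionField p) ≃ₐ[ℚ] (W.divisionField p))) :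
    haveI : NeZero p := ⟨(Fact.out : p.Prime).ne_zero⟩
    ∀ κL : ZpExtension (W.divisionField p) p, κL.IsCyclotomic → TotallyRamifiedFrom κL 0 := by
  haveI : NeZero p := ⟨(Fact.out : p.Prime).ne_zero⟩
  haveI : FiniteDimensional ℚ (W.divisionField p) := W.finiteDimensional_divisionField p
  haveI : IsGalois ℚ (W.divisionField p) := W.isGalois_divisionField p
  haveI : NumberField (W.divisionField p) := NumberField.mk
  intro κL hκL
  refine totallyRamifiedFrom_zero_of_isCyclotomic_of_pow_mem_range (W.divisionField p) p
    (Nat.card ((W.divisionField p) ≃ₐ[ℚ] (W.divisionField p))) hd (fun g => ?_) κL hκL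
  exact pow_mem_range_absGaloisRestrict_of_pow_eq_one (W.divisionField p) _ (fun s => pow_card_eq_one') g

/-- **(A) at `(W, p)` from Fukuda's class-number-ORDER certificate at the layers `(n, n+1)` of `ℚ(W[p])_cyc`,
binder-free**: granted Fukuda 1994 Thm. 1 (1) (`hF1`) and Coates–Sujatha Thm. 3.4 (`hCS`), `p ≠ 2`,
`p ∤ #Gal(ℚ(W[p])/ℚ)` and `ord_p h(L_{n+1}) = ord_p h(L_n)` give statement (A).  Displayed hypotheses are integers.
CONDITIONAL on the two facts; (A) not asserted. [cite: Fukuda1994, Thm. 1 (1), p. 264] [cite: CoatesSujatha2005, Thm. 3.4 (§3)] -/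
theorem conjA_of_classNumberPExp_succ_eq
    (hF1 : fukuda1994_thm1_classNumberPExp_const_of_succ_eq)
    (hCS : CoatesSujatha2005.thm34_fineSelmerDual_moduleFinite_of_classicalMuVanishes_divisionField)
    (W : WeierstrassCurve ℚ) [W.IsElliptic] (p : ℕ) [Fact p.Prime] (hp : p ≠ 2)
    (hd : haveI : NeZero p := ⟨(Fact.out : p.Prime).ne_zero⟩
      ¬ p ∣ Nat.card ((W.divisionField p) ≃ₐ[ℚ] (W.divisionField p))) (n : ℕ)
    (hord : haveI : NeZero p := ⟨(Fact.out : p.Prime).ne_zero⟩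
      ∀ κL : ZpExtension (W.divisionField p) p, κL.IsCyclotomic →
        classNumberPExp κL (n + 1) = classNumberPExp κL n)
    (κ : ZpExtension ℚ p) (hκ : κ.IsCyclotomic) :
    ∃ (γ : absoluteGaloisGroup ℚ) (D : W.FineSelmerDualData κ γ),
      Module.Finite ℤ_[p] (RestrictScalars ℤ_[p] (IwasawaAlgebra p) D.X) :=
  CoatesSujatha2005.fineSelmerDual_moduleFinite_of_classNumberPExp_succ_eq hF1 hCS W p hp n
    (totallyRamifiedFrom_zero_divisionField_of_not_dvd_card W p hd) hord κ hκ

/-- **(A) at `(W, p)` from Fukuda's `p`-RANK certificate at the layers `(n, n+1)`, binder-free** (Thm. 1 (2), `hF2`).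
CONDITIONAL on the two facts; (A) not asserted. [cite: Fukuda1994, Thm. 1 (2), p. 264] [cite: CoatesSujatha2005, Thm. 3.4 (§3)] -/
theorem conjA_of_classGroupPRank_succ_eq
    (hF2 : fukuda1994_thm1_classGroupPRank_const_of_succ_eq)
    (hCS : CoatesSujatha2005.thm34_fineSelmerDual_moduleFinite_of_classicalMuVanishes_divisionField)
    (W : WeierstrassCurve ℚ) [W.IsElliptic] (p : ℕ) [Fact p.Prime] (hp : p ≠ 2)
    (hd : haveI : NeZero p := ⟨(Fact.out : p.Prime).ne_zero⟩
      ¬ p ∣ Nat.card ((W.divisionField p) ≃ₐ[ℚ] (W.divisionField p))) (n : ℕ)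
    (hrk : haveI : NeZero p := ⟨(Fact.out : p.Prime).ne_zero⟩
      ∀ κL : ZpExtension (W.divisionField p) p, κL.IsCyclotomic →
        classGroupPRank κL (n + 1) = classGroupPRank κL n)
    (κ : ZpExtension ℚ p) (hκ : κ.IsCyclotomic) :
    ∃ (γ : absoluteGaloisGroup ℚ) (D : W.FineSelmerDualData κ γ),
      Module.Finite ℤ_[p] (RestrictScalars ℤ_[p] (IwasawaAlgebra p) D.X) :=
  CoatesSujatha2005.fineSelmerDual_moduleFinite_of_classGroupPRank_succ_eq hF2 hCS W p hp n
    (totallyRamifiedFrom_zero_divisionField_of_not_dvd_card W p hd) hrk κ hκ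

/-- **(A) at `(W, p)` from the Iwasawa-1956 certificate** (`p ∤ h(ℚ(W[p]))`, one prime above `p`): the Literature
door restated next to the Fukuda doors for the recorder (no `#Gal` hypothesis needed).
CONDITIONAL on the two facts; (A) not asserted. [cite: Greenberg2001IwasawaPastPresent, Prop. 2.1 p. 339] [cite: CoatesSujatha2005, Thm. 3.4 (§3)] -/
theorem conjA_of_not_dvd_classNumber_of_unique_prime
    (hIw : iwasawa1956_classNumberPExp_eq_zero_of_not_dvd_classNumber_of_unique_prime)
    (hCS : CoatesSujatha2005.thm34_fineSelmerDual_moduleFinite_of_classicalMuVanishes_divisionField)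
    (W : WeierstrassCurve ℚ) [W.IsElliptic] (p : ℕ) [Fact p.Prime] (hp : p ≠ 2)
    (hh : haveI : NeZero p := ⟨(Fact.out : p.Prime).ne_zero⟩
      haveI : NumberField (W.divisionField p) := NumberField.mk
      ¬ p ∣ NumberField.classNumber (W.divisionField p))
    (hv : haveI : NeZero p := ⟨(Fact.out : p.Prime).ne_zero⟩
      haveI : NumberField (W.divisionField p) := NumberField.mk
      ∃! v : IsDedekindDomain.HeightOneSpectrum (NumberField.RingOfIntegers (W.divisionField p)),
        ((p : ℕ) : NumberField.RingOfIntegers (W.divisionField p)) ∈ v.asIdeal)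
    (κ : ZpExtension ℚ p) (hκ : κ.IsCyclotomic) :
    ∃ (γ : absoluteGaloisGroup ℚ) (D : W.FineSelmerDualData κ γ),
      Module.Finite ℤ_[p] (RestrictScalars ℤ_[p] (IwasawaAlgebra p) D.X) :=
  CoatesSujatha2005.fineSelmerDual_moduleFinite_of_not_dvd_classNumber_of_unique_prime hIw hCS W p hp hh hv κ hκ

end Summit.BirchSwinnertonDyer.BirchSwinnertonDyer.Theorems.CartanMuRoadDoors
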